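import Summits.ValiantsHypothesis.ValiantsHypothesis.Theorems.LacunarySymmetroidMatrixDescartesVLawCore
import Summits.ValiantsHypothesis.ValiantsHypothesis.Theorems.LacunarySymmetroidMatrixDescartesVLawChain
import Summits.ValiantsHypothesis.ValiantsHypothesis.Theorems.LacunarySymmetroidMatrixDescartesStubReverse
import Summits.ValiantsHypothesis.ValiantsHypothesis.Theorems.LacunarySymmetroidMatrixDescartesCensusPivotDefs

/-!
# `MatrixDescartes` (stmt-ValiantsHypothesis-18050), line `Lift` — the FAN LAW (K-free two-sided sector law)

HONEST FRAMING.  Cell `pub-symmetroid`, seat `val-sym-mdr-p2` (gen 2); helper `--supports` the crux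
`Theses.LacunarySymmetroid.MatrixDescartes`, NO closure claim.  The companion `…StubVLaw.lean` derives from this file
the registered research stub `stub_vLaw` of line Lift (paper proof `VLAW-PROOF.md` = evidence #43 on the item,
predecessor seat g0; desk R1345).  Nothing here bears on the other registered stub `stub_twoSided` (≅ the crux), on
`MatrixDescartes` in its window, `DoorA26`/`DoorA34`, or `VP ≠ VNP`.  What is proved is a K-FREE TWO-SIDED SECTOR
LAW at every size and every number of letters (a format-level upper bound by sign/exponent structure):

**FAN LAW** (`fanLaw_lower`, mirror `fanLaw_upper`).  Let `F(X) = X^e J + ∑ k, X^{d k} P k` with `J` real symmetric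
and every `P k ⪰ 0` (`ι × ι`, any finite index type `κ` of letters).  Suppose ONE letter `k₀` lies on one side of
the pivot exponent `e` and ALL other letters lie on the other side with STRICTLY SMALLER gaps:
`|d k − e| < |d k₀ − e|` for `k ≠ k₀`.  Then `det F` has at most `2 · card ι` distinct positive zeros — for every `κ`.
The V-law (`stub_vLaw`, companion file: one PSD letter on each side, `Z₊ ≤ 2·card ι`) is the case `card κ = 2`
(whichever gap is larger is the lone letter; equal gaps = the degree count `vLaw_equalGaps`, p419950).  Consistency with the cell's
census of `> 2n` objects: each violates the fan condition (softmax staircase `{0 | 4 | 5,6,16}`: the far letter `16`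
sits on the crowded side; the `(2,1)`-witness `{1,3}|{2}` of `not_wLaw_two`; the Cameron–Psarrakos counterexample has
two letters on each side).

PROOF.  Every positive zero `t` of `det F` carries a kernel vector `v`, classified ASCENDING / DESCENDING by the sign
of the logarithmic slope `σ = −a t^{−a} vᵀP_{k₀}v + ∑_{k≠k₀} b_k t^{b_k} vᵀP_k v` of its Rayleigh quotient
(`a = |d k₀ − e|`, `b_k = |d k − e|`).  Kernel vectors at increasing ascending zeros are linearly independent by the
abstract chain lemma `VLawChain.linearIndependent_of_chain` (tree), whose positivity input is exactly the STAR core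
lemma `VLawCore.core_pos` (all earlier nodes ascending, target later); likewise for descending zeros with the order
reversed; hence `≤ card ι` of each kind.  The lone-upper case is the lone-lower case of the reflected pencil
(`stub_reverse`, tree).  [folklore] given the companion files; no new analysis here.
-/

-- layout Summits/ValiantsHypothesis/ValiantsHypothesis forces the duplicated namespace component
set_option linter.dupNamespace false

namespace Summit.ValiantsHypothesis.ValiantsHypothesis.Theorems.LacunarySymmetroidMatrixDescartes

open Polynomial Matrix Finset
open scoped BigOperators

namespace FanLaw

variable {ι : Type} [Fintype ι] [DecidableEq ι] {κ : Type} [Fintype κ] [DecidableEq κ]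

omit [Fintype ι] [DecidableEq ι] in
/-- H-form of a lower fan at `t ≠ 0`: with `a = e − d k₀` and `b k = d k − e` for `k ≠ k₀`,
`t^e J + ∑ k, t^{d k} P k = t^e • (J + (t^a)⁻¹ P_{k₀} + ∑_{k ≠ k₀} t^{b k} P k)`. [folklore] -/
theorem pencil_eq_smul_hform (e : ℕ) (d : κ → ℕ) (J : Matrix ι ι ℝ) (P : κ → Matrix ι ι ℝ) (k₀ : κ)
    (hlow : d k₀ ≤ e) (hup : ∀ k, k ≠ k₀ → e ≤ d k) {t : ℝ} (ht : t ≠ 0) :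
    t ^ e • J + ∑ k, t ^ d k • P k
      = t ^ e • (J + (t ^ (e - d k₀))⁻¹ • P k₀
          + ∑ l : {k // k ≠ k₀}, t ^ (d l.1 - e) • P l.1) := by
  rw [smul_add, smul_add, Finset.smul_sum, smul_smul, ← Finset.add_sum_erase _ _ (Finset.mem_univ k₀),
    Finset.sum_subtype (Finset.univ.erase k₀) (p := fun k => k ≠ k₀)
      (fun k => by simp [Finset.mem_erase]), add_assoc]
  congr 2
  · rw [← pow_sub₀ t ht (Nat.sub_le e (d k₀)), show e - (e - d k₀) = d k₀ by omega]
  · refine Finset.sum_congr rfl fun l _ => ?_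
    rw [smul_smul, ← pow_add, show e + (d l.1 - e) = d l.1 by have := hup l.1 l.2; omega]

/-- **Lower fan law** (pivot-pencil shape).  `J` symmetric, all `P k ⪰ 0`, a lone letter `k₀` BELOW the pivot
(`d k₀ < e`) and every other letter ABOVE it with a strictly smaller gap (`e < d k`, `d k − e < e − d k₀`): then
`det (X^e J + ∑ k, X^{d k} P k)` has at most `2 · card ι` distinct positive zeros, whatever the number of letters.
[folklore] -/
theorem fanLaw_lower (e : ℕ) (d : κ → ℕ) (J : Matrix ι ι ℝ) (P : κ → Matrix ι ι ℝ) (k₀ : κ)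
    (hJ : J.IsSymm) (hP : ∀ k, (P k).PosSemidef) (hlow : d k₀ < e)
    (hfan : ∀ k, k ≠ k₀ → e < d k ∧ d k - e < e - d k₀) :
    ((Matrix.det (((Polynomial.X : Polynomial ℝ) ^ e) • J.map Polynomial.C
        + ∑ k, ((Polynomial.X : Polynomial ℝ) ^ d k) • (P k).map Polynomial.C)).roots.toFinset.filter
          (fun t => 0 < t)).card ≤ 2 * Fintype.card ι := by
  classical
  set p := Matrix.det (((Polynomial.X : Polynomial ℝ) ^ e) • J.map Polynomial.C
        + ∑ k, ((Polynomial.X : Polynomial ℝ) ^ d k) • (P k).map Polynomial.C) with hp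
  by_cases hdet : p = 0
  · simp [hdet]
  -- the H-form data
  set a : ℕ := e - d k₀ with ha_def
  have ha : 0 < a := by omega
  set b : {k // k ≠ k₀} → ℕ := fun l => d l.1 - e with hb_def
  set n : {k // k ≠ k₀} → ℕ := fun l => a - 1 - b l with hn_def
  have hb : ∀ l, 0 < b l := fun l => by have := (hfan l.1 l.2).1; simp only [hb_def]; omega
  have hnb : ∀ l, n l + b l + 1 = a := fun l => by
    have := (hfan l.1 l.2).2; simp only [hn_def, hb_def, ha_def] at this ⊢; omega
  set Q : {k // k ≠ k₀} → Matrix ι ι ℝ := fun l => P l.1 with hQ_def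
  have hQ : ∀ l, (Q l).PosSemidef := fun l => hP l.1
  set G : ℝ → Matrix ι ι ℝ := fun t => t ^ e • J + ∑ k, t ^ d k • P k with hG
  set H : ℝ → Matrix ι ι ℝ := fun t => J + (t ^ a)⁻¹ • P k₀ + ∑ l, t ^ (b l) • Q l with hH
  have hGH : ∀ t : ℝ, t ≠ 0 → G t = t ^ e • H t := fun t ht =>
    pencil_eq_smul_hform e d J P k₀ hlow.le (fun k hk => (hfan k hk).1.le) ht
  set R := p.roots.toFinset.filter (fun t => 0 < t) with hR
  have hroot : ∀ t ∈ R, 0 < t ∧ Matrix.det (G t) = 0 := by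
    intro t ht
    have h1 := (Finset.mem_filter.1 ht)
    rw [Multiset.mem_toFinset, Polynomial.mem_roots hdet, Polynomial.IsRoot.def, hp,
      StubReverse.eval_det_pencil] at h1
    exact ⟨h1.2, h1.1⟩
  -- kernel vectors of `G t` are kernel vectors of `H t` (`t > 0`)
  have hkerH : ∀ t : ℝ, 0 < t → ∀ v : ι → ℝ, G t *ᵥ v = 0 → H t *ᵥ v = 0 := by
    intro t ht v hv
    rw [hGH t ht.ne', smul_mulVec, smul_eq_zero] at hv
    exact hv.resolve_left (pow_ne_zero e ht.ne')
  -- nondegeneracy from `p ≠ 0`: no nonzero vector is killed by all the letters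
  have hnd : ∀ v : ι → ℝ, v ≠ 0 → ¬ (J *ᵥ v = 0 ∧ P k₀ *ᵥ v = 0 ∧ ∀ l, Q l *ᵥ v = 0) := by
    rintro v hv ⟨hJv, hPv, hQv⟩
    apply hdet
    apply Polynomial.eq_zero_of_infinite_isRoot
    refine Set.infinite_of_forall_exists_gt fun t₀ => ⟨max t₀ 0 + 1, ?_, by
      have := le_max_left t₀ 0; linarith⟩
    have ht : (0 : ℝ) < max t₀ 0 + 1 := by have := le_max_right t₀ 0; linarith
    rw [Set.mem_setOf_eq, Polynomial.IsRoot.def, hp, StubReverse.eval_det_pencil]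
    have hGv : G (max t₀ 0 + 1) *ᵥ v = 0 := by
      rw [hGH _ ht.ne', smul_mulVec, add_mulVec, add_mulVec, smul_mulVec, hJv, hPv, smul_zero, add_zero,
        Matrix.sum_mulVec, Finset.sum_eq_zero (fun l _ => by rw [smul_mulVec, hQv l, smul_zero]), add_zero,
        smul_zero]
    exact (Matrix.exists_mulVec_eq_zero_iff.1 ⟨v, hv, hGv⟩)
  -- slope of the Rayleigh quotient at a node
  set σ : ℝ → (ι → ℝ) → ℝ := fun t v =>
    -((a : ℝ) * (t ^ a)⁻¹ * (v ⬝ᵥ (P k₀ *ᵥ v))) + ∑ l, (b l : ℝ) * t ^ (b l) * (v ⬝ᵥ (Q l *ᵥ v)) with hσ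
  set TA : ℝ → Prop := fun t => ∃ v : ι → ℝ, v ≠ 0 ∧ G t *ᵥ v = 0 ∧ 0 ≤ σ t v with hTA
  set TD : ℝ → Prop := fun t => ∃ v : ι → ℝ, v ≠ 0 ∧ G t *ᵥ v = 0 ∧ σ t v ≤ 0 with hTD
  have hcover : R ⊆ R.filter TA ∪ R.filter TD := by
    intro t ht
    obtain ⟨v, hv, hGv⟩ := Matrix.exists_mulVec_eq_zero_iff.2 (hroot t ht).2
    rcases le_total 0 (σ t v) with h | h
    · exact Finset.mem_union.2 (Or.inl (Finset.mem_filter.2 ⟨ht, v, hv, hGv, h⟩))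
    · exact Finset.mem_union.2 (Or.inr (Finset.mem_filter.2 ⟨ht, v, hv, hGv, h⟩))
  -- the STAR core lemma, specialised: nodes all ascending and left of `s`, or all descending and right of `s`
  have hcore : ∀ (m : ℕ) (u : Fin m → ℝ) (w : Fin m → ι → ℝ), (∀ j, 0 < u j) → Function.Injective u →
      (∀ j, w j ≠ 0) → (∀ j, G (u j) *ᵥ w j = 0) → ∀ s : ℝ, 0 < s → (∀ j, s ≠ u j) →
      (∀ j, 0 ≤ (s - u j) * σ (u j) (w j)) → ∀ c : Fin m → ℝ, c ≠ 0 →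
      0 < (∑ j, c j • w j) ⬝ᵥ (G s *ᵥ ∑ j, c j • w j) := by
    intro m u w hu huinj hw0 hker s hs hsu hstar c hc
    have h := VLawCore.core_pos a ha b n hnb hb J (P k₀) Q hJ (hP k₀) hQ u hu huinj w
      (fun j => hkerH _ (hu j) _ (hker j)) s hs hsu hstar (fun j => hnd _ (hw0 j)) c hc
    rw [hGH s hs.ne', smul_mulVec, dotProduct_smul, smul_eq_mul]
    exact mul_pos (pow_pos hs e) h
  -- ascending zeros: at most `card ι`
  have hcardA : (R.filter TA).card ≤ Fintype.card ι := by
    set RA := R.filter TA with hRA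
    let τ : Fin RA.card ↪o ℝ := RA.orderEmbOfFin rfl
    have hτmem : ∀ j, τ j ∈ RA := fun j => RA.orderEmbOfFin_mem rfl j
    have hτA : ∀ j, TA (τ j) := fun j => (Finset.mem_filter.1 (hτmem j)).2
    have hτpos : ∀ j, 0 < τ j := fun j => (hroot _ (Finset.mem_filter.1 (hτmem j)).1).1
    choose v hv0 hker htyp using hτA
    have hli : LinearIndependent ℝ v :=
      VLawChain.linearIndependent_of_chain G τ v hv0 hker fun j hj _ c hc =>
        hcore j (fun i => τ (Fin.castLE hj.le i)) (fun i => v (Fin.castLE hj.le i))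
          (fun i => hτpos _)
          (fun i i' h => Fin.castLE_injective hj.le (τ.injective h))
          (fun i => hv0 _) (fun i => hker _) (τ ⟨j, hj⟩) (hτpos _)
          (fun i => (τ.strictMono (show Fin.castLE hj.le i < ⟨j, hj⟩ from i.2)).ne')
          (fun i => mul_nonneg (sub_nonneg.2
            (τ.strictMono (show Fin.castLE hj.le i < ⟨j, hj⟩ from i.2)).le) (htyp _)) c hc
    have h := hli.fintype_card_le_finrank
    rwa [Fintype.card_fin, Module.finrank_fintype_fun_eq_card] at h
  -- descending zeros: at most `card ι` (enumerate decreasingly)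
  have hcardD : (R.filter TD).card ≤ Fintype.card ι := by
    set RD := R.filter TD with hRD
    let τ₀ : Fin RD.card ↪o ℝ := RD.orderEmbOfFin rfl
    set τ : Fin RD.card → ℝ := fun j => τ₀ (Fin.rev j) with hτ
    have hτanti : StrictAnti τ := fun i i' h => τ₀.strictMono (Fin.rev_lt_rev.2 h)
    have hτmem : ∀ j, τ j ∈ RD := fun j => RD.orderEmbOfFin_mem rfl (Fin.rev j)
    have hτD : ∀ j, TD (τ j) := fun j => (Finset.mem_filter.1 (hτmem j)).2
    have hτpos : ∀ j, 0 < τ j := fun j => (hroot _ (Finset.mem_filter.1 (hτmem j)).1).1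
    choose v hv0 hker htyp using hτD
    have hli : LinearIndependent ℝ v :=
      VLawChain.linearIndependent_of_chain G τ v hv0 hker fun j hj _ c hc =>
        hcore j (fun i => τ (Fin.castLE hj.le i)) (fun i => v (Fin.castLE hj.le i))
          (fun i => hτpos _)
          (fun i i' h => Fin.castLE_injective hj.le (hτanti.injective h))
          (fun i => hv0 _) (fun i => hker _) (τ ⟨j, hj⟩) (hτpos _)
          (fun i => (hτanti (show Fin.castLE hj.le i < ⟨j, hj⟩ from i.2)).ne)
          (fun i => mul_nonneg_of_nonpos_of_nonpos (sub_nonpos.2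
            (hτanti (show Fin.castLE hj.le i < ⟨j, hj⟩ from i.2)).le) (htyp _)) c hc
    have h := hli.fintype_card_le_finrank
    rwa [Fintype.card_fin, Module.finrank_fintype_fun_eq_card] at h
  calc R.card ≤ (R.filter TA ∪ R.filter TD).card := Finset.card_le_card hcover
    _ ≤ (R.filter TA).card + (R.filter TD).card := Finset.card_union_le _ _
    _ ≤ Fintype.card ι + Fintype.card ι := Nat.add_le_add hcardA hcardD
    _ = 2 * Fintype.card ι := by ring

/-- **Upper fan law** (mirror): a lone letter `k₀` ABOVE the pivot (`e < d k₀`) and every other letter BELOW it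
with a strictly smaller gap (`d k < e`, `e − d k < d k₀ − e`) ⇒ at most `2 · card ι` distinct positive zeros.  From the
lower fan law applied to the reflected pencil `X ↦ X⁻¹` (tree `stub_reverse`). [folklore] -/
theorem fanLaw_upper (e : ℕ) (d : κ → ℕ)
    (J : Matrix ι ι ℝ) (P : κ → Matrix ι ι ℝ) (k₀ : κ) (hJ : J.IsSymm) (hP : ∀ k, (P k).PosSemidef)
    (hup : e < d k₀) (hfan : ∀ k, k ≠ k₀ → d k < e ∧ e - d k < d k₀ - e) :
    ((Matrix.det (((Polynomial.X : Polynomial ℝ) ^ e) • J.map Polynomial.C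
        + ∑ k, ((Polynomial.X : Polynomial ℝ) ^ d k) • (P k).map Polynomial.C)).roots.toFinset.filter
          (fun t => 0 < t)).card ≤ 2 * Fintype.card ι := by
  have hd : ∀ k, d k ≤ d k₀ := by
    intro k
    by_cases hk : k = k₀
    · rw [hk]
    · have := (hfan k hk).1; omega
  rw [stub_reverse ι κ e (d k₀) d J P hup.le hd]
  refine fanLaw_lower (d k₀ - e) (fun k => d k₀ - d k) J P k₀ hJ hP (show d k₀ - d k₀ < d k₀ - e by omega)
    fun k hk => ?_
  have := hfan k hk
  show d k₀ - e < d k₀ - d k ∧ d k₀ - d k - (d k₀ - e) < d k₀ - e - (d k₀ - d k₀)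
  omega

end FanLaw

open FanLaw

/-- The fan laws in the census currency of the pivot column (`…CensusPivotDefs`): for a `(m, K)` pivot pencil with
a lone letter on one side of the pivot and all other letters on the other side with strictly smaller gaps,
`pivotPosRoots e d J P ≤ 2 m` — uniformly in `K` (a K-free two-sided rung beyond `OneSidedIndexRung`). [folklore] -/
theorem pivotPosRoots_fan_le (m K e : ℕ) (d : Fin K → ℕ) (J : Matrix (Fin m) (Fin m) ℝ)
    (P : Fin K → Matrix (Fin m) (Fin m) ℝ) (k₀ : Fin K) (hJ : J.IsSymm) (hP : ∀ k, (P k).PosSemidef)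
    (hfan : (d k₀ < e ∧ ∀ k, k ≠ k₀ → e < d k ∧ d k - e < e - d k₀)
      ∨ (e < d k₀ ∧ ∀ k, k ≠ k₀ → d k < e ∧ e - d k < d k₀ - e)) :
    Pivot.pivotPosRoots e d J P ≤ 2 * m := by
  unfold Pivot.pivotPosRoots
  rcases hfan with ⟨hlow, h⟩ | ⟨hup, h⟩
  · simpa using fanLaw_lower e d J P k₀ hJ hP hlow h
  · simpa using fanLaw_upper e d J P k₀ hJ hP hup h

end Summit.ValiantsHypothesis.ValiantsHypothesis.Theorems.LacunarySymmetroidMatrixDescartes
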